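import Summits.Ventures.CertifiedManyBodySolver.Downfold.EmeryShapeTrueCornerBand
import Summits.Ventures.CertifiedManyBodySolver.Downfold.EmeryFermiScalePointsHg1223IPC2TrueCorners
import HarnessLib

/-!
# THE ONE-BAND FERMI-SURFACE SHAPE `t′/t` OF THE WHOLE TYPED 3BE BOX `emeryBoxHg1223IP (EmeryBoxesTrilayer) — t_pp′ PIECE [0.145, 0.185]` OVER ITS WHOLE FILLING BAND, AT ITS TWO TRUE CORNERS (true-corner rule, band form,
# §B.87 (j); router/EMERY-SHAPE-CORNERS.tsv «true band» rows)

Venture CertifiedManyBodySolver, cell `pub/hubbard-downfold` (stage S1; INFLATION-RULES-3to1-B §B.87 (j)), seat hubbard-downfold-mod-4 (technique B, g35); namespace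
`Summit.Ventures.CertifiedManyBodySolver.Downfold.Emery`. Everything PROVED (0 sorry; no new certificate — the end-filling brackets of the per-filling files are re-read).
WHAT THIS IS NOT: a statement about HgBa₂Ca₂Cu₃O₈ INNER plane (typed companion) — the typed box is SCREENING-GRADE; `U = 0` one-body kinematics of the σ model (rigid band).

For EVERY one-body row of `[1.23, 2.02] × [1.16, 1.44] × [0.6, 0.76] × [0.145, 0.185]` eV AND EVERY filling `ν ∈ [2/5, 43/100]` the one-band `t′/t` lies in **[-0.3484, -0.2567]**: the true-corner
squeeze `fsRatio_fermiEnergyOf_trueCorner_lower_band` / `…_upper_band` (`EmeryShapeTrueCornerBand`: slab windows `[pL, qL] = [16077/10000, 3561/2000]`, `[pU, qU] = [459/250, 2487/1250]`, regime `qT = 11463/5000`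
certified at the END fillings; margin constants lower slab M_b 0.7301 / M_c 0.0501, upper slab M_b 3.8099 / M_c 0.0), read at the true corners over their band windows
`[331/200, 8713/5000]` (lipschitz) and `[9369/5000, 19417/10000]` (monotone) (`fermiEnergyOf_mem_Icc_of_band`). Comparator (certified, g19 sub-box device, n_H band): [-0.3623,-0.243] (n_H band).

Sources: three-band model [HybertsenSchluterChristensen1989, Eq. (1)]; [AndersenEtAl1995, §6]; box rows as cited in the typed object's file.
-/

noncomputable section

namespace Summit.Ventures.CertifiedManyBodySolver.Downfold.Emery

open Real Set

/-- **filling band ν ∈ [2/5, 43/100] (n_H = 1.20 (ν = 2/5) … n_H = 1.14 (ν = 43/100)): for every row of the box AND every filling of the band the one-band Fermi-surface `t′/t` (object E) lies in `[-0.3484, -0.2567]` — between its values at the two TRUE corners** (band form of the true-corner rule; margins by `norm_num`). [folklore] -/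
theorem hg1223IPC2Box_fsRatio_true_band {Δ a b c ν : ℝ} (hΔ : Δ ∈ Icc ((123 : ℝ) / 100) ((101 : ℝ) / 50)) (ha : a ∈ Icc ((29 : ℝ) / 25) ((36 : ℝ) / 25)) (hb : b ∈ Icc ((3 : ℝ) / 5) ((19 : ℝ) / 25)) (hc : c ∈ Icc ((29 : ℝ) / 200) ((37 : ℝ) / 200)) (hν : ν ∈ Icc ((2 : ℝ) / 5) ((43 : ℝ) / 100)) :
    fsRatio Δ a b c (fermiEnergyOf Δ a b c ν) ∈ Icc ((-871 : ℝ) / 2500) ((-2567 : ℝ) / 10000) := by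
  have hSL := (fermiEnergyOf_of_pointBracketCheck truePt_Hg1223IPC2SL_nH120_br (by norm_num) (by norm_num) (by norm_num) (ν := (2/5 : ℝ)) (by push_cast; exact ⟨le_rfl, le_rfl⟩)).2
  have hAlo := (fermiEnergyOf_of_pointBracketCheck truePt_Hg1223IPC2AL_nH114_br (by norm_num) (by norm_num) (by norm_num) (ν := (43/100 : ℝ)) (by push_cast; exact ⟨le_rfl, le_rfl⟩)).2
  have hTop := (fermiEnergyOf_of_pointBracketCheck truePt_Hg1223IPC2HH_nH114_br (by norm_num) (by norm_num) (by norm_num) (ν := (43/100 : ℝ)) (by push_cast; exact ⟨le_rfl, le_rfl⟩)).2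
  have hSU := (fermiEnergyOf_of_pointBracketCheck truePt_Hg1223IPC2SU_nH120_br (by norm_num) (by norm_num) (by norm_num) (ν := (2/5 : ℝ)) (by push_cast; exact ⟨le_rfl, le_rfl⟩)).2
  have hQU := (fermiEnergyOf_of_pointBracketCheck truePt_Hg1223IPC2QU_nH114_br (by norm_num) (by norm_num) (by norm_num) (ν := (43/100 : ℝ)) (by push_cast; exact ⟨le_rfl, le_rfl⟩)).2
  have hTL1 := (fermiEnergyOf_of_pointBracketCheck truePt_Hg1223IPC2TL_nH120_br (by norm_num) (by norm_num) (by norm_num) (ν := (2/5 : ℝ)) (by push_cast; exact ⟨le_rfl, le_rfl⟩)).2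
  have hTL2 := (fermiEnergyOf_of_pointBracketCheck truePt_Hg1223IPC2TL_nH114_br (by norm_num) (by norm_num) (by norm_num) (ν := (43/100 : ℝ)) (by push_cast; exact ⟨le_rfl, le_rfl⟩)).2
  have hTH1 := (fermiEnergyOf_of_pointBracketCheck truePt_Hg1223IPC2TH_nH120_br (by norm_num) (by norm_num) (by norm_num) (ν := (2/5 : ℝ)) (by push_cast; exact ⟨le_rfl, le_rfl⟩)).2
  have hTH2 := (fermiEnergyOf_of_pointBracketCheck truePt_Hg1223IPC2TH_nH114_br (by norm_num) (by norm_num) (by norm_num) (ν := (43/100 : ℝ)) (by push_cast; exact ⟨le_rfl, le_rfl⟩)).2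
  push_cast at hSL hAlo hTop hSU hQU hTL1 hTL2 hTH1 hTH2
  norm_num at hSL hAlo hTop hSU hQU hTL1 hTL2 hTH1 hTH2
  obtain ⟨hΔl, hΔu⟩ := hΔ
  obtain ⟨hal, hau⟩ := ha
  have hTL := fermiEnergyOf_mem_Icc_of_band (Δ := ((123 : ℝ) / 100)) (a := ((29 : ℝ) / 25)) (b := ((19 : ℝ) / 25)) (c := ((37 : ℝ) / 200)) (e₁ := ((331 : ℝ) / 200)) (e₂ := ((8713 : ℝ) / 5000)) (by norm_num) (by norm_num) (by norm_num) (by norm_num) (by norm_num) hν (by norm_num) hTL1.1 hTL2.2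
  have hTH := fermiEnergyOf_mem_Icc_of_band (Δ := ((101 : ℝ) / 50)) (a := ((36 : ℝ) / 25)) (b := ((3 : ℝ) / 5)) (c := ((29 : ℝ) / 200)) (e₁ := ((9369 : ℝ) / 5000)) (e₂ := ((19417 : ℝ) / 10000)) (by norm_num) (by norm_num) (by norm_num) (by norm_num) (by norm_num) hν (by norm_num) hTH1.1 hTH2.2
  constructor
  · have hlow := fsRatio_fermiEnergyOf_trueCorner_lower_band (Δ₁ := ((123 : ℝ) / 100)) (a₁ := ((29 : ℝ) / 25)) (b₁ := ((3 : ℝ) / 5)) (b₂ := ((19 : ℝ) / 25)) (c₁ := ((29 : ℝ) / 200)) (c₂ := ((37 : ℝ) / 200)) (ν₁ := ((2 : ℝ) / 5)) (ν₂ := ((43 : ℝ) / 100))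
      (pL := ((16077 : ℝ) / 10000)) (qL := ((3561 : ℝ) / 2000)) (Mb := ((7301 : ℝ) / 10000)) (Mc := ((501 : ℝ) / 10000)) (by norm_num) hΔl (by norm_num) hal (by norm_num) hb (by norm_num) hc (by norm_num) (by norm_num) hν (by norm_num)
      (by norm_num) hSL.1 hAlo.2 (by norm_num) (by norm_num [fsD, fsN]) (by norm_num) (by norm_num) (by norm_num [fsD, fsN]) (by norm_num) (by norm_num [dopingDisc]) (by norm_num [fsD, fsN])
    refine le_trans ?_ hlow
    have hw := fsRatio_ge_on_window (Δ := ((123 : ℝ) / 100)) (a := ((29 : ℝ) / 25)) (b := ((19 : ℝ) / 25)) (c := ((37 : ℝ) / 200)) (p := ((331 : ℝ) / 200)) (q := ((8713 : ℝ) / 5000))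
      (M := ((279 : ℝ) / 2500)) (by norm_num) (by norm_num) (by norm_num) (by norm_num) (by norm_num [fsD, fsN]) (by norm_num [dopingDisc]) (by norm_num [dopingDisc]) hTL
    refine le_trans ?_ hw
    norm_num [fsRatio, fsD, fsN]
  · have hup := fsRatio_fermiEnergyOf_trueCorner_upper_band (Δ₁ := ((123 : ℝ) / 100)) (Δ₂ := ((101 : ℝ) / 50)) (a₁ := ((29 : ℝ) / 25)) (a₂ := ((36 : ℝ) / 25)) (b₁ := ((3 : ℝ) / 5)) (b₂ := ((19 : ℝ) / 25)) (c₁ := ((29 : ℝ) / 200)) (c₂ := ((37 : ℝ) / 200)) (ν₁ := ((2 : ℝ) / 5)) (ν₂ := ((43 : ℝ) / 100))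
      (pU := ((459 : ℝ) / 250)) (qU := ((2487 : ℝ) / 1250)) (qT := ((11463 : ℝ) / 5000)) (Mb := ((38099 : ℝ) / 10000)) (Mc := (0 : ℝ)) (by norm_num) ⟨hΔl, hΔu⟩ (by norm_num) ⟨hal, hau⟩ (by norm_num) hb (by norm_num) hc (by norm_num) (by norm_num) hν (by norm_num)
      hTop.2 (by norm_num) (by norm_num) hSU.1 hQU.2 (by norm_num) (by norm_num [fsD, fsN]) (by norm_num) (by norm_num) (by norm_num [fsD, fsN]) (by norm_num) (by norm_num) (by norm_num [fsD, fsN])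
    refine le_trans hup ?_
    have hw := (fsRatio_mem_Icc_on_window_of_dopingDisc_nonpos (Δ := ((101 : ℝ) / 50)) (a := ((36 : ℝ) / 25)) (b := ((3 : ℝ) / 5)) (c := ((29 : ℝ) / 200))
      (p := ((9369 : ℝ) / 5000)) (q := ((19417 : ℝ) / 10000)) (by norm_num) (by norm_num) (by norm_num) (by norm_num) (by norm_num) (by norm_num) (by norm_num) (by norm_num [dopingDisc]) hTH).2
    refine le_trans hw ?_
    norm_num [fsRatio, fsD, fsN]

end Summit.Ventures.CertifiedManyBodySolver.Downfold.Emery
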